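import Summits.Ventures.LatticeQCDFlow.Scaling.UnitSurvivalPotential

/-!
HONEST FRAMING: exact (Metropolis-corrected) sampling algorithms for lattice gauge theory; figures
of merit are autocorrelation/cost numbers at stated couplings and volumes; no continuum-physics
claim.

# LazyHotUnitSurvival — THE SURVIVAL POTENTIAL WITH A TUNABLE HUB VALUE `θ`: FOR THE IDEALISED HOT-ONLY STAR WHOSE HOT
# KERNEL HOLDS WITH PROBABILITY `≥ 1 − a` (`M_0(u,u) ≥ 1 − a`: a lazy, Doeblin-`a` or low-acceptance hot sampler),
# `PΨ_s^θ ≥ (1 − t(1−θ)ĉ/m)·Ψ_s^θ` WHENEVER `θ ≤ t + (1−t)(1−a)θ`, I.E. UP TO `θ* = t/(t + a(1−t))`, AND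
# `E_xΨ(X_n) ≥ (1 − t(1−θ)ĉ/m)ⁿΨ(x)` (lean-2 GEN-27, ours)

Venture-side (OURS).  Cell `lqcd-flow` (pub-lqcd), unit `pub-lqcd-lean-2-g27`, 2026-08-27/28.  Chapter M, the floor
side, file 9 — `Scaling/UnitSurvivalPotential` (hub value `θ = t`, any hot kernel) sharpened for hot kernels that move
slowly.  Setting: the idealised hot-only star of `Scaling/IdealStarThreeTermLaw` (one positive law `ν` at every level,
identity maps, hub list `e_r = (0, κ_r+1)` with every cold level listed at most `ĉ` times, hot-only updates with a
row-stochastic hot kernel `M_0`), plus the HOLDING hypothesis `M_0(u,u) ≥ 1 − a`.  The potential is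
`Ψ_s^θ(z) = 1` if some cold level holds `s`, `θ` if only the hub does, `0` otherwise (`0 ≤ θ ≤ 1`).  At a hub-only
state every swap carries the copy to a cold level (`Ψ → 1`) and the hot update keeps it with probability `≥ 1 − a`, so
`PΨ ≥ t + (1−t)(1−a)θ`, which is `≥ θ` exactly when `θ ≤ θ* = t/(t + a(1−t))`; at a cold state a swap costs `1 − θ`
only when it carries the last cold copy to the hub (at most `ĉ` of the `m` entries).  The rate `t(1−θ*)ĉ/m =
(tĉ/m)·a(1−t)/(t + a(1−t))` is the hub's capture rate times the odds that a captured unit is refreshed (`a(1−t)` per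
step) before it escapes (`t` per step) — the heuristic `λ₁ ≈ (tc/m)·h/(t+h)` of `OPEN-MATH-chapterM.md` item 2 with
`h = a(1−t)`.

## What is proved

* §1 `survPotθ_nonneg`, `survPotθ_le_one`, `survPotθ_le_indicator`, `survPotθ_swap_ge` (a swap costs at most `1 − θ`,
  and only when it carries the last cold copy to the hub), `survPotθ_swap_of_hubOnly`.
* §2 **`lazy_scheme_survPot_ge`** — `M_0(u,u) ≥ 1 − a`, `θ ≤ t + (1−t)(1−a)θ`:
  `Σ_z P(y,z)Ψ(z) ≥ (1 − t(1−θ)ĉ/m)·Ψ(y)`.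
* §3 **`lazy_scheme_lawAt_survPot_ge`** — `E_xΨ(X_n) ≥ (1 − t(1−θ)ĉ/m)ⁿ·Ψ(x)` (`ĉ ≤ m`).

Reading (no numerics implied): the floor side now sees the hot sampler's refresh odds: a flow proposal accepted with
probability `≤ a` cannot mix the ladder faster than `(m/(tĉ))·(t + a(1−t))/(a(1−t))` steps (`Scaling/LazyHotUnitSurvivalFloor`).
NOT CLAIMED: cold-level moves (the star is hot-only); the `log K`; anything measured.  Literature grade (cell rule):
OWN RESULT; nothing cited as a fact; no new bib keys.
-/

noncomputable section

open Finset Function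
open Literature.Probability.MarkovChains

namespace Summit.Ventures.LatticeQCDFlow.Scaling

variable {S : Type*} [Fintype S] [DecidableEq S] {K m : ℕ} {ν : S → ℝ} {M : Fin (K + 1) → S → S → ℝ} {t θ a : ℝ}

section LazySurvival
variable (κ : Fin m → Fin K)

/-! ## §1 The potential with hub value `θ` -/

omit [Fintype S] in
/-- `Ψ ≥ 0` (`θ ≥ 0`). [ours] -/
theorem survPotθ_nonneg (hθ0 : 0 ≤ θ) (s : S) {Ψ : (Fin (K + 1) → S) → ℝ}
    (hΨ : ∀ z, Ψ z = if (∃ k : Fin K, z k.succ = s) then (1 : ℝ) else (if z 0 = s then θ else 0))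
    (z : Fin (K + 1) → S) : 0 ≤ Ψ z := by
  rw [hΨ]; split_ifs <;> linarith

omit [Fintype S] in
/-- `Ψ ≤ 1` (`θ ≤ 1`). [ours] -/
theorem survPotθ_le_one (hθ1 : θ ≤ 1) (s : S) {Ψ : (Fin (K + 1) → S) → ℝ}
    (hΨ : ∀ z, Ψ z = if (∃ k : Fin K, z k.succ = s) then (1 : ℝ) else (if z 0 = s then θ else 0))
    (z : Fin (K + 1) → S) : Ψ z ≤ 1 := by
  rw [hΨ]; split_ifs <;> linarith

omit [Fintype S] in
/-- **`Ψ ≤ 𝟙{∃ k, z_k = s}`** (`θ ≤ 1`). [ours] -/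
theorem survPotθ_le_indicator (hθ1 : θ ≤ 1) (s : S) {Ψ : (Fin (K + 1) → S) → ℝ}
    (hΨ : ∀ z, Ψ z = if (∃ k : Fin K, z k.succ = s) then (1 : ℝ) else (if z 0 = s then θ else 0))
    (z : Fin (K + 1) → S) :
    Ψ z ≤ if (∃ k ∈ (univ : Finset (Fin (K + 1))), z k = (fun _ : Fin (K + 1) => s) k) then (1 : ℝ) else 0 := by
  rw [hΨ]
  by_cases hc : ∃ k : Fin K, z k.succ = s
  · obtain ⟨k, hk⟩ := hc
    rw [if_pos ⟨k, hk⟩, if_pos ⟨k.succ, mem_univ _, hk⟩]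
  · rw [if_neg hc]
    by_cases h0 : z 0 = s
    · rw [if_pos h0, if_pos ⟨0, mem_univ _, h0⟩]; exact hθ1
    · rw [if_neg h0]; split_ifs <;> norm_num

omit [Fintype S] in
/-- **A SWAP COSTS AT MOST `1 − θ`, AND ONLY WHEN IT CARRIES THE LAST COLD COPY TO THE HUB** (`θ ≤ 1`). [ours] -/
theorem survPotθ_swap_ge (hθ1 : θ ≤ 1) (s : S) {Ψ : (Fin (K + 1) → S) → ℝ}
    (hΨ : ∀ z, Ψ z = if (∃ k : Fin K, z k.succ = s) then (1 : ℝ) else (if z 0 = s then θ else 0))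
    (r : Fin m) (y : Fin (K + 1) → S) (hy : ∃ k : Fin K, y k.succ = s) :
    1 - (1 - θ) * (if (y (κ r).succ = s ∧ ∀ k : Fin K, k ≠ κ r → y k.succ ≠ s) then (1 : ℝ) else 0)
      ≤ Ψ (edgeFlowSwap (Equiv.refl S) 0 (κ r).succ y) := by
  obtain ⟨h0, hl, hoff⟩ := hubSwap_apply κ r y
  by_cases hother : ∃ k : Fin K, k ≠ κ r ∧ y k.succ = s
  · obtain ⟨k, hk, hks⟩ := hother
    have hcold : ∃ k' : Fin K, edgeFlowSwap (Equiv.refl S) 0 (κ r).succ y k'.succ = s := ⟨k, by rw [hoff k hk, hks]⟩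
    rw [hΨ, if_pos hcold]
    split_ifs <;> nlinarith
  · push Not at hother
    obtain ⟨k₀, hk₀⟩ := hy
    have hkr : k₀ = κ r := by
      by_contra h; exact hother k₀ h hk₀
    subst hkr
    rw [if_pos ⟨hk₀, fun k hk => hother k hk⟩, mul_one]
    have hhub : edgeFlowSwap (Equiv.refl S) 0 (κ r).succ y 0 = s := by rw [h0, hk₀]
    rw [hΨ]
    split_ifs <;> linarith

omit [Fintype S] in
/-- **A HUB-ONLY COPY IS CARRIED TO A COLD LEVEL BY EVERY SWAP:** `y_0 = s` ⇒ `Ψ(swap_r y) = 1`. [ours] -/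
theorem survPotθ_swap_of_hubOnly (s : S) {Ψ : (Fin (K + 1) → S) → ℝ}
    (hΨ : ∀ z, Ψ z = if (∃ k : Fin K, z k.succ = s) then (1 : ℝ) else (if z 0 = s then θ else 0))
    (r : Fin m) (y : Fin (K + 1) → S) (hy0 : y 0 = s) : Ψ (edgeFlowSwap (Equiv.refl S) 0 (κ r).succ y) = 1 := by
  obtain ⟨_, hl, _⟩ := hubSwap_apply κ r y
  rw [hΨ, if_pos ⟨κ r, by rw [hl, hy0]⟩]

/-! ## §2 One step with a holding hot kernel -/

/-- **THE ONE-STEP SUBMARTINGALE WITH A HOLDING HOT KERNEL: `Σ_z P(y,z)Ψ(z) ≥ (1 − t(1−θ)ĉ/m)·Ψ(y)`** for the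
idealised hot-only star, `M_0` row-stochastic with `M_0(u,u) ≥ 1 − a`, `0 ≤ t ≤ 1`, `0 ≤ θ ≤ 1`,
`θ ≤ t + (1−t)(1−a)θ`, multiplicities `≤ ĉ`, `m ≥ 1`. [ours] -/
theorem lazy_scheme_survPot_ge (hm : 1 ≤ m) (ht0 : 0 ≤ t) (ht1 : t ≤ 1) (hθ0 : 0 ≤ θ) (hθ1 : θ ≤ 1)
    (hν : ∀ v, 0 < ν v) (hM : ∀ k, IsRowStochastic (M k)) (hhold : ∀ u, 1 - a ≤ M 0 u u)
    (hθ : θ ≤ t + (1 - t) * (1 - a) * θ)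
    {cmax : ℕ} (hc : ∀ p' : Fin K, (univ.filter (fun r : Fin m => κ r = p')).card ≤ cmax)
    (s : S) {Ψ : (Fin (K + 1) → S) → ℝ}
    (hΨ : ∀ z, Ψ z = if (∃ k : Fin K, z k.succ = s) then (1 : ℝ) else (if z 0 = s then θ else 0))
    (y : Fin (K + 1) → S) :
    (1 - t * (1 - θ) * cmax / m) * Ψ y ≤ ∑ z, (t * ptGraphSwap (fun _ : Fin (K + 1) => ν)
          (fun r : Fin m => (((0 : Fin (K + 1)), (κ r).succ) : Fin (K + 1) × Fin (K + 1))) (fun _ => Equiv.refl S) y z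
        + (1 - t) * prodKernel (fun k : Fin (K + 1) => if k = 0 then (1 : ℝ) else 0) M y z) * Ψ z := by
  have hmpos : (0 : ℝ) < m := Nat.cast_pos.mpr (by omega)
  have hsplit : ∑ z, (t * ptGraphSwap (fun _ : Fin (K + 1) => ν)
          (fun r : Fin m => (((0 : Fin (K + 1)), (κ r).succ) : Fin (K + 1) × Fin (K + 1))) (fun _ => Equiv.refl S) y z
        + (1 - t) * prodKernel (fun k : Fin (K + 1) => if k = 0 then (1 : ℝ) else 0) M y z) * Ψ z
      = t * ((1 / (m : ℝ)) * ∑ r : Fin m, Ψ (edgeFlowSwap (Equiv.refl S) 0 (κ r).succ y))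
        + (1 - t) * ∑ v, M 0 (y 0) v * Ψ (update y 0 v) := by
    rw [← ideal_swapMean κ hm hν Ψ y, ← hotOnly_updateMean (M := M) Ψ y, Finset.mul_sum, Finset.mul_sum,
      ← Finset.sum_add_distrib]
    exact sum_congr rfl fun z _ => by ring
  rw [hsplit]
  have hΨ0 := survPotθ_nonneg hθ0 s hΨ
  have hlam0 : 0 ≤ t * (1 - θ) * (cmax : ℝ) / m :=
    div_nonneg (mul_nonneg (mul_nonneg ht0 (by linarith)) (Nat.cast_nonneg _)) (Nat.cast_nonneg _)
  by_cases hcold : ∃ k : Fin K, y k.succ = s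
  · -- case A: a cold copy; swaps cost at most `(1−θ)ĉ/m`, the hot update nothing
    have hΨy : Ψ y = 1 := by rw [hΨ, if_pos hcold]
    have hswap : (m : ℝ) - (1 - θ) * cmax ≤ ∑ r : Fin m, Ψ (edgeFlowSwap (Equiv.refl S) 0 (κ r).succ y) := by
      have h1 := sum_le_sum fun r (_ : r ∈ (univ : Finset (Fin m))) => survPotθ_swap_ge κ hθ1 s hΨ r y hcold
      rw [Finset.sum_sub_distrib, sum_const, card_univ, Fintype.card_fin, nsmul_eq_mul, mul_one, ← Finset.mul_sum] at h1
      have h2 := mul_le_mul_of_nonneg_left (onlyCopy_count_le κ hc s y hcold) (by linarith : (0 : ℝ) ≤ 1 - θ)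
      linarith
    have hupd : ∑ v, M 0 (y 0) v * Ψ (update y 0 v) = 1 := by
      have hΨv : ∀ v, Ψ (update y 0 v) = 1 := fun v => by
        obtain ⟨k, hk⟩ := hcold
        rw [hΨ, if_pos ⟨k, by rw [update_of_ne (Fin.succ_ne_zero k), hk]⟩]
      simp_rw [hΨv, mul_one]
      exact (hM 0).2 (y 0)
    rw [hΨy, hupd, mul_one]
    have h3 : t * (1 - (1 - θ) * cmax / m)
        ≤ t * ((1 / (m : ℝ)) * ∑ r : Fin m, Ψ (edgeFlowSwap (Equiv.refl S) 0 (κ r).succ y)) := by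
      refine mul_le_mul_of_nonneg_left ?_ ht0
      rw [show 1 - (1 - θ) * (cmax : ℝ) / m = (1 / (m : ℝ)) * ((m : ℝ) - (1 - θ) * cmax) by field_simp]
      exact mul_le_mul_of_nonneg_left hswap (by positivity)
    have e : 1 - t * (1 - θ) * (cmax : ℝ) / m = t * (1 - (1 - θ) * cmax / m) + (1 - t) * 1 := by ring
    rw [e]
    linarith
  · by_cases h0 : y 0 = s
    · -- case B: the hub only; every swap rescues, the hot update keeps the copy with probability `≥ 1 − a`
      have hΨy : Ψ y = θ := by rw [hΨ, if_neg hcold, if_pos h0]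
      have hswap : ∑ r : Fin m, Ψ (edgeFlowSwap (Equiv.refl S) 0 (κ r).succ y) = m := by
        rw [sum_congr rfl fun r _ => survPotθ_swap_of_hubOnly κ s hΨ r y h0, sum_const, card_univ, Fintype.card_fin,
          nsmul_eq_mul, mul_one]
      have hupd : (1 - a) * θ ≤ ∑ v, M 0 (y 0) v * Ψ (update y 0 v) := by
        have hkeep : M 0 (y 0) (y 0) * Ψ (update y 0 (y 0)) = M 0 (y 0) (y 0) * θ := by rw [update_eq_self, hΨy]
        have h1 := Finset.single_le_sum (f := fun v => M 0 (y 0) v * Ψ (update y 0 v))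
          (fun v _ => mul_nonneg ((hM 0).1 _ _) (hΨ0 _)) (mem_univ (y 0))
        rw [hkeep] at h1
        exact (mul_le_mul_of_nonneg_right (hhold (y 0)) hθ0).trans h1
      rw [hΨy, hswap, one_div_mul_cancel hmpos.ne', mul_one]
      have h2 := mul_le_mul_of_nonneg_left hupd (by linarith : (0 : ℝ) ≤ 1 - t)
      have h3 : (1 - t * (1 - θ) * (cmax : ℝ) / m) * θ ≤ θ := by nlinarith
      linarith
    · -- case C: no copy at all
      have hΨy : Ψ y = 0 := by rw [hΨ, if_neg hcold, if_neg h0]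
      rw [hΨy, mul_zero]
      exact add_nonneg (mul_nonneg ht0 (mul_nonneg (by positivity) (sum_nonneg fun r _ => hΨ0 _)))
        (mul_nonneg (by linarith) (sum_nonneg fun v _ => mul_nonneg ((hM 0).1 _ _) (hΨ0 _)))

/-! ## §3 `n` steps -/

/-- **`E_x Ψ(X_n) ≥ (1 − t(1−θ)ĉ/m)ⁿ·Ψ(x)`** with a holding hot kernel (`ĉ ≤ m`). [ours] -/
theorem lazy_scheme_lawAt_survPot_ge (hm : 1 ≤ m) (ht0 : 0 ≤ t) (ht1 : t ≤ 1) (hθ0 : 0 ≤ θ) (hθ1 : θ ≤ 1)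
    (hν : ∀ v, 0 < ν v) (hM : ∀ k, IsRowStochastic (M k)) (hhold : ∀ u, 1 - a ≤ M 0 u u)
    (hθ : θ ≤ t + (1 - t) * (1 - a) * θ)
    {cmax : ℕ} (hc : ∀ p' : Fin K, (univ.filter (fun r : Fin m => κ r = p')).card ≤ cmax) (hcm : cmax ≤ m)
    (s : S) {Ψ : (Fin (K + 1) → S) → ℝ}
    (hΨ : ∀ z, Ψ z = if (∃ k : Fin K, z k.succ = s) then (1 : ℝ) else (if z 0 = s then θ else 0))
    (x : Fin (K + 1) → S) (n : ℕ) :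
    (1 - t * (1 - θ) * cmax / m) ^ n * Ψ x
      ≤ lawMean (lawAt (fun y z : Fin (K + 1) → S => (t * ptGraphSwap (fun _ : Fin (K + 1) => ν)
          (fun r : Fin m => (((0 : Fin (K + 1)), (κ r).succ) : Fin (K + 1) × Fin (K + 1))) (fun _ => Equiv.refl S) y z
        + (1 - t) * prodKernel (fun k : Fin (K + 1) => if k = 0 then (1 : ℝ) else 0) M y z)) (Pi.single x 1) n) Ψ := by
  have hμ : ∀ (k : Fin (K + 1)) (v : S), 0 < (fun _ : Fin (K + 1) => ν) k v := fun _ v => hν v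
  have hw0 : ∀ k : Fin (K + 1), 0 ≤ (if k = 0 then (1 : ℝ) else 0) := fun k => by split_ifs <;> norm_num
  have hw1 : ∑ k : Fin (K + 1), (if k = 0 then (1 : ℝ) else 0) = 1 := by
    rw [Finset.sum_ite_eq' univ (0 : Fin (K + 1)), if_pos (mem_univ _)]
  have hP := weightedScheme_isRowStochastic (t := t) (w := fun k : Fin (K + 1) => if k = 0 then (1 : ℝ) else 0)
    (ptGraphSwap_isRowStochastic (e := fun r : Fin m => (((0 : Fin (K + 1)), (κ r).succ) : Fin (K + 1) × Fin (K + 1)))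
      (φ := fun _ => Equiv.refl S) hμ) hM hw0 hw1 ht0 ht1
  have hmpos : (0 : ℝ) < m := Nat.cast_pos.mpr (by omega)
  have hlamle : 0 ≤ 1 - t * (1 - θ) * (cmax : ℝ) / m := by
    rw [sub_nonneg, div_le_one hmpos]
    have hcm' : (cmax : ℝ) ≤ m := by exact_mod_cast hcm
    have h1 : t * (1 - θ) ≤ 1 := by nlinarith
    have h2 : 0 ≤ t * (1 - θ) := mul_nonneg ht0 (by linarith)
    nlinarith
  have hstep : ∀ y, ∑ z, (t * ptGraphSwap (fun _ : Fin (K + 1) => ν)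
          (fun r : Fin m => (((0 : Fin (K + 1)), (κ r).succ) : Fin (K + 1) × Fin (K + 1))) (fun _ => Equiv.refl S) y z
        + (1 - t) * prodKernel (fun k : Fin (K + 1) => if k = 0 then (1 : ℝ) else 0) M y z) * (-Ψ z) ≤ (1 - t * (1 - θ) * cmax / m) * (-Ψ y) := fun y => by
    have h := lazy_scheme_survPot_ge κ hm ht0 ht1 hθ0 hθ1 hν hM hhold hθ hc s hΨ y
    simp_rw [mul_neg, Finset.sum_neg_distrib]
    linarith
  have h := lawMean_lawAt_le_of_step_le hP hlamle hstep (μ := Pi.single x 1) (fun a => by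
    by_cases ha : a = x
    · subst ha; rw [Pi.single_eq_same]; norm_num
    · rw [Pi.single_eq_of_ne ha]) n
  have hneg : ∀ μ' : (Fin (K + 1) → S) → ℝ, lawMean μ' (fun z => -Ψ z) = -lawMean μ' Ψ := fun μ' => by
    unfold lawMean; rw [← Finset.sum_neg_distrib]; exact sum_congr rfl fun z _ => by ring
  rw [hneg, hneg, lawMean_single] at h
  linarith

end LazySurvival

end Summit.Ventures.LatticeQCDFlow.Scaling

end
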